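import Summits.AtomisticToContinuum.HydrodynamicLimit.Theorems.JParityClosureLocalSecondLawLedgerDefs
import Summits.AtomisticToContinuum.HydrodynamicLimit.Theorems.JParityClosureDensityCapGridUpgrade
import Literature.Analysis.FunctionSpaces.TorusSpaceTimeFields

/-!
# Tools for the regular range of the entropy-ledger line (stub F = `stub_regularRange`, crux
# `JParityClosure.LocalSecondLaw`, stmt-AtomisticToContinuum-13081)

Deterministic and Euler-side tools for the reduction `regularRange_of_fieldLLN`
(`Theorems/JParityClosureLocalSecondLawRegularRangeReduction.lean`) of stub F — the event
`LocalSecondLawLedger.Regular σ r τ c η₁ Φ z` (good orbit and `c ≤ ρ_r`, `ρ_rσ³ ≤ η₁`, `c ≤ θ_r` on all of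
`[0, τ] × 𝕋³`) — to the fixed-time field law of large numbers:

* `rr_modulus`, `rr_exists_floor`, `rr_exists_bound`: joint modulus of continuity, positive floor and
  uniform bound on `[0, τ] × 𝕋³` of a field whose space–time lift is continuous on `[0, τ] × ℝ³`
  (Heine–Cantor / extreme values on the compact cylinder `[0, τ] × B̄(0, 2)`, read at the representatives
  `reprSym x`, `reprSym x + reprSym (x' − x)`, as in `densMod_modulus`);
* `rr_abs_kinC_sub_le_centre`, `rr_norm_momC_sub_le_centre`: the coarse kinetic energy and momentum are
  `3/(πr⁴) ke`- resp. `3/(πr⁴)(1/2 + ke)`-Lipschitz in the CENTRE (kernel bound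
  `gridUp_abs_cone_sub_cone_le`, `‖v‖ ≤ (1 + ‖v‖²)/2`);
* `rr_norm_integral_cone_smul_sub_le`, `rr_abs_integral_cone_mul_sub_le`: the two-sided cone-average
  error `‖∫ b_r(y, x) g(y) dy − g(x)‖ ≤ η` from a modulus of `g` on the ball (`∫ b_r = 1`, support, sign);
* `regularAt_of_fieldsClose` (registered sub-goal): at ONE point, `ε`-closeness of `(ρ_r, m_r, e_r)` to a
  limit state `(ρ̄, ρ̄ū, E(ρ̄, ū, θ̄))` with `ρ̄, θ̄ ≥ 2c`, `‖ū‖ ≤ B`, cap margin `ρ̄σ³ + ε|σ³| ≤ η₁` and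
  `ε(B² + 2B + 3c + 2) ≤ c²` gives the regular inequalities `c ≤ ρ_r`, `ρ_rσ³ ≤ η₁`, `c ≤ θ_r` (pure real
  arithmetic; hot or dense limit states only help the temperature floor, so only `‖ū‖` needs a bound).

References: elementary; C. Kipnis, C. Landim, *Scaling Limits of Interacting Particle Systems* (1999),
Ch. 4 (from fixed-time to uniform statements through moduli of continuity). Vocabulary:
`Theorems/JParityClosureLocalSecondLawLedgerDefs.lean`, `Theorems/LocalSecondLaw/Negative/Functional.lean`.
-/

noncomputable section

namespace Summit.AtomisticToContinuum.HydrodynamicLimit.Theorems.LocalSecondLawLedger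

open scoped BigOperators Topology Classical MeasureTheory ENNReal InnerProductSpace
open Filter Set MeasureTheory
open Literature.MathematicalPhysics.KineticTheory
open Literature.Analysis.FluidPDE
open Literature.Analysis.FunctionSpaces (Torus.stLift Torus.stLift_apply Torus.proj Torus.proj_add
  Torus.continuous_slice_of_continuousOn_stLift Torus.continuousOn_stLift_comp₂)
open Summit.AtomisticToContinuum.HydrodynamicLimit.Theorems.LocalSecondLawNegative

/-! ## Euler-side inputs from continuity of the space–time lifts -/

/-- Every point of `[0, τ] × 𝕋³` has a representative in the compact cylinder `[0, τ] × B̄(0, 2)`. -/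
theorem rr_mem_cyl {τ s : ℝ} (hs : s ∈ Icc 0 τ) (x : T3) :
    ((s, Torus.reprSym x) : ℝ × EuclideanSpace ℝ (Fin 3)) ∈
      Icc 0 τ ×ˢ Metric.closedBall (0 : EuclideanSpace ℝ (Fin 3)) 2 := by
  refine mk_mem_prod hs ?_
  rw [Metric.mem_closedBall, dist_zero_right]
  linarith [densMod_norm_reprSym_le_one x]

/-- **Joint modulus of continuity on `[0, τ] × 𝕋³`** (Heine–Cantor on the compact cylinder, read at
representatives): for a field with continuous space–time lift on `[0, τ] × ℝ³` and `η > 0` there is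
`δ > 0` with `‖f s x − f s' x'‖ < η` whenever `|s − s'| < δ` and the minimal-image distance of `x, x'`
is `< δ`. -/
theorem rr_modulus {F : Type*} [NormedAddCommGroup F] {τ : ℝ} {f : ℝ → T3 → F}
    (hf : ContinuousOn (Torus.stLift f) (Icc 0 τ ×ˢ univ)) {η : ℝ} (hη : 0 < η) :
    ∃ δ : ℝ, 0 < δ ∧ ∀ s ∈ Icc 0 τ, ∀ s' ∈ Icc 0 τ, |s - s'| < δ →
      ∀ x x' : T3, Torus.euclidDist x x' < δ → ‖f s x - f s' x'‖ < η := by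
  have hKc : IsCompact (Icc 0 τ ×ˢ Metric.closedBall (0 : EuclideanSpace ℝ (Fin 3)) 2) :=
    isCompact_Icc.prod (isCompact_closedBall 0 2)
  have hKS : Icc 0 τ ×ˢ Metric.closedBall (0 : EuclideanSpace ℝ (Fin 3)) 2 ⊆ Icc 0 τ ×ˢ univ :=
    prod_mono Subset.rfl (subset_univ _)
  obtain ⟨δ, hδ, hU⟩ :=
    Metric.uniformContinuousOn_iff.1 (hKc.uniformContinuousOn_of_continuous (hf.mono hKS)) η hη
  refine ⟨δ, hδ, fun s hs s' hs' hss' x x' hxx' => ?_⟩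
  have h1 := rr_mem_cyl hs x
  have h2 : ((s', Torus.reprSym x + Torus.reprSym (x' - x)) : ℝ × EuclideanSpace ℝ (Fin 3)) ∈
      Icc 0 τ ×ˢ Metric.closedBall (0 : EuclideanSpace ℝ (Fin 3)) 2 := by
    refine mk_mem_prod hs' ?_
    rw [Metric.mem_closedBall, dist_zero_right]
    calc ‖Torus.reprSym x + Torus.reprSym (x' - x)‖
        ≤ ‖Torus.reprSym x‖ + ‖Torus.reprSym (x' - x)‖ := norm_add_le _ _
      _ ≤ 1 + 1 := add_le_add (densMod_norm_reprSym_le_one x) (densMod_norm_reprSym_le_one _)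
      _ = 2 := by norm_num
  have hdist : dist ((s, Torus.reprSym x) : ℝ × EuclideanSpace ℝ (Fin 3))
      (s', Torus.reprSym x + Torus.reprSym (x' - x)) < δ := by
    rw [Prod.dist_eq, max_lt_iff]
    refine ⟨?_, ?_⟩
    · show dist s s' < δ
      rwa [Real.dist_eq]
    · show dist (Torus.reprSym x) (Torus.reprSym x + Torus.reprSym (x' - x)) < δ
      rw [dist_eq_norm, sub_add_cancel_left, norm_neg, ← Torus.euclidDist_eq,
        Torus.euclidDist_comm]
      exact hxx'
  have h := hU _ h1 _ h2 hdist
  rw [dist_eq_norm, Torus.stLift_apply, Torus.stLift_apply, Torus.proj_add, Torus.proj_reprSym,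
    Torus.proj_reprSym, add_sub_cancel] at h
  exact h

/-- **A positive floor** for a field with continuous space–time lift that is positive on
`[0, τ] × 𝕋³`, `τ ≥ 0` (extreme value theorem on the compact cylinder). -/
theorem rr_exists_floor {τ : ℝ} (hτ : 0 ≤ τ) {f : ℝ → T3 → ℝ}
    (hf : ContinuousOn (Torus.stLift f) (Icc 0 τ ×ˢ univ)) (hpos : ∀ s ∈ Icc 0 τ, ∀ x, 0 < f s x) :
    ∃ m : ℝ, 0 < m ∧ ∀ s ∈ Icc 0 τ, ∀ x, m ≤ f s x := by
  have hKc : IsCompact (Icc 0 τ ×ˢ Metric.closedBall (0 : EuclideanSpace ℝ (Fin 3)) 2) :=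
    isCompact_Icc.prod (isCompact_closedBall 0 2)
  have hKS : Icc 0 τ ×ˢ Metric.closedBall (0 : EuclideanSpace ℝ (Fin 3)) 2 ⊆ Icc 0 τ ×ˢ univ :=
    prod_mono Subset.rfl (subset_univ _)
  have hne : (Icc 0 τ ×ˢ Metric.closedBall (0 : EuclideanSpace ℝ (Fin 3)) 2).Nonempty :=
    ⟨(0, 0), mk_mem_prod ⟨le_rfl, hτ⟩ (Metric.mem_closedBall_self (by norm_num))⟩
  obtain ⟨p, hp, hmin⟩ := hKc.exists_isMinOn hne (hf.mono hKS)
  refine ⟨Torus.stLift f p, ?_, fun s hs x => ?_⟩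
  · obtain ⟨p1, p2⟩ := p
    rw [Torus.stLift_apply]
    exact hpos p1 (mem_prod.1 hp).1 _
  · have h := hmin (rr_mem_cyl hs x)
    rw [mem_setOf_eq, Torus.stLift_apply (t := s), Torus.proj_reprSym] at h
    exact h

/-- **A uniform bound** for a field with continuous space–time lift on `[0, τ] × 𝕋³`. -/
theorem rr_exists_bound {F : Type*} [NormedAddCommGroup F] {τ : ℝ} {f : ℝ → T3 → F}
    (hf : ContinuousOn (Torus.stLift f) (Icc 0 τ ×ˢ univ)) :
    ∃ B : ℝ, 0 ≤ B ∧ ∀ s ∈ Icc 0 τ, ∀ x, ‖f s x‖ ≤ B := by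
  have hKc : IsCompact (Icc 0 τ ×ˢ Metric.closedBall (0 : EuclideanSpace ℝ (Fin 3)) 2) :=
    isCompact_Icc.prod (isCompact_closedBall 0 2)
  have hKS : Icc 0 τ ×ˢ Metric.closedBall (0 : EuclideanSpace ℝ (Fin 3)) 2 ⊆ Icc 0 τ ×ˢ univ :=
    prod_mono Subset.rfl (subset_univ _)
  obtain ⟨C, hC⟩ := hKc.exists_bound_of_continuousOn (hf.mono hKS)
  refine ⟨max C 0, le_max_right _ _, fun s hs x => ?_⟩
  have h := hC _ (rr_mem_cyl hs x)
  rw [Torus.stLift_apply, Torus.proj_reprSym] at h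
  exact h.trans (le_max_left _ _)

/-! ## The cone kernel: symmetry and Lipschitz bounds in the centre (support, unit mass and continuity in
the particle variable are `densMod_cone_eq_zero`, `densMod_integral_cone_eq_one`, `densMod_continuous_cone`) -/

/-- The cone kernel is symmetric. -/
theorem rr_cone_comm (r : ℝ) (y x : T3) : cone r y x = cone r x y := by
  unfold cone
  rw [Torus.euclidDist_comm]

/-- Lipschitz bound of the cone kernel in the CENTRE: `|b_r(y, x) − b_r(y, x')| ≤ 3/(πr⁴) d(x, x')`. -/
theorem rr_abs_cone_sub_cone_centre {r : ℝ} (hr : 0 < r) (y x x' : T3) :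
    |cone r y x - cone r y x'| ≤ 3 / (Real.pi * r ^ 4) * Torus.euclidDist x x' := by
  rw [rr_cone_comm r y x, rr_cone_comm r y x']
  exact gridUp_abs_cone_sub_cone_le hr x x' y

/-- The mean kinetic energy per particle is `(N+1)⁻¹ · configEnergy`. -/
theorem rr_ke_eq {N : ℕ} (w : Phase N) : ke w = ((N + 1 : ℕ) : ℝ)⁻¹ * configEnergy w := by
  unfold ke configEnergy
  rw [← Finset.sum_div]
  ring

/-- **Centre-Lipschitz bound of the coarse kinetic energy**:
`|e_r(w)(x) − e_r(w)(x')| ≤ 3/(πr⁴) d(x, x') · ke(w)`. -/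
theorem rr_abs_kinC_sub_le_centre {r : ℝ} (hr : 0 < r) {N : ℕ} (w : Phase N) (x x' : T3) :
    |kinC r w x - kinC r w x'| ≤ 3 / (Real.pi * r ^ 4) * Torus.euclidDist x x' * ke w := by
  have hn : (0 : ℝ) < ((N + 1 : ℕ) : ℝ) := by positivity
  rw [kinC_eq_sum, kinC_eq_sum, ← mul_sub, ← Finset.sum_sub_distrib, abs_mul,
    abs_of_nonneg (inv_nonneg.2 hn.le)]
  unfold ke
  have hterm : ∀ i : Fin (N + 1), |cone r (w i).1 x * (‖(w i).2‖ ^ 2 / 2) - cone r (w i).1 x' * (‖(w i).2‖ ^ 2 / 2)|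
      ≤ 3 / (Real.pi * r ^ 4) * Torus.euclidDist x x' * (‖(w i).2‖ ^ 2 / 2) := by
    intro i
    rw [← sub_mul, abs_mul, abs_of_nonneg (by positivity : (0 : ℝ) ≤ ‖(w i).2‖ ^ 2 / 2)]
    exact mul_le_mul_of_nonneg_right (rr_abs_cone_sub_cone_centre hr _ x x') (by positivity)
  calc ((N + 1 : ℕ) : ℝ)⁻¹ * |∑ i, (cone r (w i).1 x * (‖(w i).2‖ ^ 2 / 2) - cone r (w i).1 x' * (‖(w i).2‖ ^ 2 / 2))|
      ≤ ((N + 1 : ℕ) : ℝ)⁻¹ * ∑ i, |cone r (w i).1 x * (‖(w i).2‖ ^ 2 / 2) - cone r (w i).1 x' * (‖(w i).2‖ ^ 2 / 2)| :=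
        mul_le_mul_of_nonneg_left (Finset.abs_sum_le_sum_abs _ _) (inv_nonneg.2 hn.le)
    _ ≤ ((N + 1 : ℕ) : ℝ)⁻¹ * ∑ i, 3 / (Real.pi * r ^ 4) * Torus.euclidDist x x' * (‖(w i).2‖ ^ 2 / 2) := by
        gcongr with i _
        exact hterm i
    _ = 3 / (Real.pi * r ^ 4) * Torus.euclidDist x x' * (((N + 1 : ℕ) : ℝ)⁻¹ * ∑ i, ‖(w i).2‖ ^ 2 / 2) := by
        rw [← Finset.mul_sum]
        ring

/-- The coarse momentum as a finite average. -/
theorem rr_momC_eq_sum (r : ℝ) {N : ℕ} (w : Phase N) (x : T3) :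
    momC r w x = ((N + 1 : ℕ) : ℝ)⁻¹ • ∑ i, cone r (w i).1 x • (w i).2 :=
  empiricalMomentumField_eq_sum w (fun y => cone r y x)

/-- **Centre-Lipschitz bound of the coarse momentum**:
`‖m_r(w)(x) − m_r(w)(x')‖ ≤ 3/(πr⁴) d(x, x') · (1/2 + ke(w))` (`‖v‖ ≤ (1 + ‖v‖²)/2`). -/
theorem rr_norm_momC_sub_le_centre {r : ℝ} (hr : 0 < r) {N : ℕ} (w : Phase N) (x x' : T3) :
    ‖momC r w x - momC r w x'‖ ≤ 3 / (Real.pi * r ^ 4) * Torus.euclidDist x x' * (1 / 2 + ke w) := by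
  have hn : (0 : ℝ) < ((N + 1 : ℕ) : ℝ) := by positivity
  have hL : 0 ≤ 3 / (Real.pi * r ^ 4) * Torus.euclidDist x x' :=
    mul_nonneg (div_nonneg (by norm_num) (by positivity)) (by rw [Torus.euclidDist_eq]; positivity)
  rw [rr_momC_eq_sum, rr_momC_eq_sum, ← smul_sub, ← Finset.sum_sub_distrib, norm_smul,
    Real.norm_eq_abs, abs_of_nonneg (inv_nonneg.2 hn.le)]
  have hterm : ∀ i : Fin (N + 1), ‖cone r (w i).1 x • (w i).2 - cone r (w i).1 x' • (w i).2‖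
      ≤ 3 / (Real.pi * r ^ 4) * Torus.euclidDist x x' * ((1 + ‖(w i).2‖ ^ 2) / 2) := by
    intro i
    rw [← sub_smul, norm_smul, Real.norm_eq_abs]
    have hv : ‖(w i).2‖ ≤ (1 + ‖(w i).2‖ ^ 2) / 2 := by nlinarith [sq_nonneg (‖(w i).2‖ - 1)]
    exact mul_le_mul (rr_abs_cone_sub_cone_centre hr _ x x') hv (norm_nonneg _) hL
  have hke : ((N + 1 : ℕ) : ℝ)⁻¹ * ∑ i : Fin (N + 1), (1 + ‖(w i).2‖ ^ 2) / 2 = 1 / 2 + ke w := by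
    unfold ke
    have hsplit : ∑ i : Fin (N + 1), (1 + ‖(w i).2‖ ^ 2) / 2 =
        ((N + 1 : ℕ) : ℝ) * (1 / 2) + ∑ i : Fin (N + 1), ‖(w i).2‖ ^ 2 / 2 := by
      rw [Finset.sum_congr rfl fun i _ => add_div (1 : ℝ) (‖(w i).2‖ ^ 2) 2, Finset.sum_add_distrib,
        Finset.sum_const, Finset.card_univ, Fintype.card_fin, nsmul_eq_mul]
    rw [hsplit, mul_add, ← mul_assoc, inv_mul_cancel₀ hn.ne', one_mul]
  calc ((N + 1 : ℕ) : ℝ)⁻¹ * ‖∑ i, (cone r (w i).1 x • (w i).2 - cone r (w i).1 x' • (w i).2)‖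
      ≤ ((N + 1 : ℕ) : ℝ)⁻¹ * ∑ i, ‖cone r (w i).1 x • (w i).2 - cone r (w i).1 x' • (w i).2‖ :=
        mul_le_mul_of_nonneg_left (norm_sum_le _ _) (inv_nonneg.2 hn.le)
    _ ≤ ((N + 1 : ℕ) : ℝ)⁻¹ * ∑ i, 3 / (Real.pi * r ^ 4) * Torus.euclidDist x x' * ((1 + ‖(w i).2‖ ^ 2) / 2) := by
        gcongr with i _
        exact hterm i
    _ = 3 / (Real.pi * r ^ 4) * Torus.euclidDist x x' * (((N + 1 : ℕ) : ℝ)⁻¹ * ∑ i : Fin (N + 1), (1 + ‖(w i).2‖ ^ 2) / 2) := by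
        rw [← Finset.mul_sum]
        ring
    _ = 3 / (Real.pi * r ^ 4) * Torus.euclidDist x x' * (1 / 2 + ke w) := by rw [hke]

/-! ## Two-sided mollification error of a continuous field -/

/-- **Two-sided cone-average error** (vector-valued): if `‖g y − g x‖ ≤ η` on the minimal-image ball
`d(y, x) < r`, `0 < r ≤ 1/2`, then `‖∫ b_r(y, x) • g y dy − g x‖ ≤ η` (unit mass, nonnegativity and
support of the kernel). -/
theorem rr_norm_integral_cone_smul_sub_le {F : Type*} [NormedAddCommGroup F] [NormedSpace ℝ F]
    [CompleteSpace F] {r η : ℝ} (hr : 0 < r) (hr2 : r ≤ 1 / 2) {g : T3 → F}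
    (hg : Continuous g) (x : T3) (hmod : ∀ y, Torus.euclidDist y x < r → ‖g y - g x‖ ≤ η) :
    ‖(∫ y, cone r y x • g y) - g x‖ ≤ η := by
  have hcc : Continuous fun y : T3 => cone r y x := densMod_continuous_cone r x
  have hone : ∫ y, cone r y x = 1 := densMod_integral_cone_eq_one hr hr2 x
  have hi1 : Integrable (fun y => cone r y x • g y) := (hcc.smul hg).integrable_unitAddTorus
  have hi2 : Integrable (fun y => cone r y x • g x) := (hcc.smul continuous_const).integrable_unitAddTorus
  have h1 : (∫ y, cone r y x • g y) - g x = ∫ y, cone r y x • (g y - g x) := by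
    have hint : ∫ y, cone r y x • g x = g x := by
      rw [integral_smul_const, hone, one_smul]
    calc (∫ y, cone r y x • g y) - g x = (∫ y, cone r y x • g y) - ∫ y, cone r y x • g x := by rw [hint]
      _ = ∫ y, (cone r y x • g y - cone r y x • g x) := (integral_sub hi1 hi2).symm
      _ = ∫ y, cone r y x • (g y - g x) := integral_congr_ae (ae_of_all _ fun y => (smul_sub _ _ _).symm)
  have hpt : ∀ y, ‖cone r y x • (g y - g x)‖ ≤ cone r y x * η := by
    intro y
    rw [norm_smul, Real.norm_eq_abs, abs_of_nonneg (cone_nonneg hr y x)]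
    by_cases hyx : Torus.euclidDist y x < r
    · exact mul_le_mul_of_nonneg_left (hmod y hyx) (cone_nonneg hr y x)
    · have h0 : cone r y x = 0 := densMod_cone_eq_zero hr (not_lt.1 hyx)
      rw [h0, zero_mul, zero_mul]
  rw [h1]
  calc ‖∫ y, cone r y x • (g y - g x)‖ ≤ ∫ y, ‖cone r y x • (g y - g x)‖ := norm_integral_le_integral_norm _
    _ ≤ ∫ y, cone r y x * η :=
        integral_mono (hcc.smul (hg.sub continuous_const)).norm.integrable_unitAddTorus
          (hcc.mul continuous_const).integrable_unitAddTorus hpt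
    _ = η := by rw [integral_mul_const, hone, one_mul]

/-- **Two-sided cone-average error** (scalar): `|∫ b_r(y, x) f y dy − f x| ≤ η` under the same
hypotheses. -/
theorem rr_abs_integral_cone_mul_sub_le {r η : ℝ} (hr : 0 < r) (hr2 : r ≤ 1 / 2)
    {f : T3 → ℝ} (hf : Continuous f) (x : T3)
    (hmod : ∀ y, Torus.euclidDist y x < r → |f y - f x| ≤ η) :
    |(∫ y, cone r y x * f y) - f x| ≤ η := by
  have h := rr_norm_integral_cone_smul_sub_le (F := ℝ) hr hr2 hf x
    (fun y hy => by rw [Real.norm_eq_abs]; exact hmod y hy)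
  simpa only [smul_eq_mul, Real.norm_eq_abs] using h

/-! ## The regular range at one point from closeness of the coarse fields -/

/-- **The regular inequalities at one point** (registered sub-goal `regularAt_of_fieldsClose`; pure real
arithmetic): if the limit state has
`ρ̄ ≥ 2c`, `θ̄ ≥ 2c`, `‖ū‖ ≤ B`, cap margin `ρ̄σ³ + ε|σ³| ≤ η₁`, and the coarse fields are within `ε` of
`(ρ̄, ρ̄ū, E(ρ̄, ū, θ̄))` with `ε (B² + 2B + 3c + 2) ≤ c²`, then `c ≤ ρ_r`, `ρ_rσ³ ≤ η₁` and
`c ≤ θ_r = (2/3)(e_r/ρ_r − |m_r|²/(2ρ_r²))` (large `θ̄`, `ρ̄` only help the floor). -/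
theorem regularAt_of_fieldsClose :
  ∀ (σ η₁ c B ε ρb θb ρr er : ℝ) (ub mr : V3), 0 < c → 2 * c ≤ ρb → 2 * c ≤ θb → 0 ≤ B → ‖ub‖ ≤ B →
    ρb * σ ^ 3 + ε * |σ ^ 3| ≤ η₁ → 0 ≤ ε → ε * (B ^ 2 + 2 * B + 3 * c + 2) ≤ c ^ 2 →
    |ρr - ρb| ≤ ε → ‖mr - ρb • ub‖ ≤ ε → |er - totalEnergyDensity ρb ub θb| ≤ ε →
    c ≤ ρr ∧ ρr * σ ^ 3 ≤ η₁ ∧ c ≤ 2 / 3 * (er / ρr - ‖mr‖ ^ 2 / (2 * ρr ^ 2)) := by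
  intro σ η₁ c B ε ρb θb ρr er ub mr hc hρb hθb hB0 hB hcap hε0 hεD hρ hm he
  have hρb0 : 0 < ρb := by linarith
  have hB2 : 0 ≤ B ^ 2 := sq_nonneg B
  have hD3 : 3 * c + 2 ≤ B ^ 2 + 2 * B + 3 * c + 2 := by linarith
  have hε32 : ε * (3 * c + 2) ≤ c ^ 2 := (mul_le_mul_of_nonneg_left hD3 hε0).trans hεD
  have hεc2 : 2 * ε ≤ c ^ 2 := by
    have h : ε * 2 ≤ ε * (3 * c + 2) := mul_le_mul_of_nonneg_left (by linarith) hε0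
    linarith
  have hεc : 3 * ε ≤ c := by
    by_contra h
    have h' := mul_lt_mul_of_pos_right (not_le.1 h) hc
    linarith
  have hρr1 : ρb - ε ≤ ρr := by linarith [(abs_le.1 hρ).1]
  have hρr2 : ρr ≤ ρb + ε := by linarith [(abs_le.1 hρ).2]
  have hρr0 : 0 < ρr := by linarith
  refine ⟨by linarith, ?_, ?_⟩
  · -- the cap
    have h1 : (ρr - ρb) * σ ^ 3 ≤ ε * |σ ^ 3| :=
      calc (ρr - ρb) * σ ^ 3 ≤ |(ρr - ρb) * σ ^ 3| := le_abs_self _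
        _ = |ρr - ρb| * |σ ^ 3| := abs_mul _ _
        _ ≤ ε * |σ ^ 3| := mul_le_mul_of_nonneg_right hρ (abs_nonneg _)
    linarith [h1]
  · -- the temperature floor
    set U : ℝ := ‖ub‖ with hU
    have hU0 : 0 ≤ U := norm_nonneg _
    have hU2 : U ^ 2 ≤ B ^ 2 := pow_le_pow_left₀ hU0 hB 2
    have hμ : ‖ρb • ub‖ = ρb * U := by rw [norm_smul, Real.norm_eq_abs, abs_of_pos hρb0]
    have hmr : ‖mr‖ ≤ ρb * U + ε := by
      calc ‖mr‖ = ‖(mr - ρb • ub) + ρb • ub‖ := by rw [sub_add_cancel]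
        _ ≤ ‖mr - ρb • ub‖ + ‖ρb • ub‖ := norm_add_le _ _
        _ ≤ ε + ρb * U := add_le_add hm hμ.le
        _ = ρb * U + ε := by ring
    have hM2 : ‖mr‖ ^ 2 ≤ (ρb * U + ε) ^ 2 := pow_le_pow_left₀ (norm_nonneg _) hmr 2
    have hE : totalEnergyDensity ρb ub θb = ρb * (U ^ 2 / 2 + 3 / 2 * θb) := rfl
    have her : ρb * (U ^ 2 / 2 + 3 / 2 * θb) - ε ≤ er := by
      have h := (abs_le.1 he).1
      rw [hE] at h
      linarith
    have key : 3 * c * ρr ^ 2 ≤ 2 * er * ρr - ‖mr‖ ^ 2 := by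
      have h2er : 2 * (ρb * (U ^ 2 / 2 + 3 / 2 * θb) - ε) * ρr ≤ 2 * er * ρr := by
        have h := mul_le_mul_of_nonneg_right her (by linarith : (0 : ℝ) ≤ 2 * ρr)
        linarith
      have hP : 3 * c * ρr ^ 2 + (ρb * U + ε) ^ 2 ≤ 2 * (ρb * (U ^ 2 / 2 + 3 / 2 * θb) - ε) * ρr := by
        have f1 : 0 ≤ ρb * U ^ 2 * (ρr - ρb + ε) :=
          mul_nonneg (mul_nonneg hρb0.le (sq_nonneg U)) (by linarith)
        have f2 : 3 * ρb * ρr * (2 * c) ≤ 3 * ρb * ρr * θb :=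
          mul_le_mul_of_nonneg_left hθb (by positivity)
        have f3 : 3 * c * ρr * ρr ≤ 3 * c * ρr * (ρb + ε) :=
          mul_le_mul_of_nonneg_left hρr2 (by positivity)
        have hcc : c * (2 * c) ≤ c * ρb := mul_le_mul_of_nonneg_left hρb hc.le
        have f4 : ρb / 2 * (2 * c * ρb) ≤ ρr * (3 * c * ρb - 2 * ε - 3 * c * ε) := by
          have g1 : ρb / 2 ≤ ρr := by linarith
          have g2 : 2 * c * ρb ≤ 3 * c * ρb - 2 * ε - 3 * c * ε := by linarith [sq_nonneg c]
          have g3 : 0 ≤ 2 * c * ρb := by positivity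
          calc ρb / 2 * (2 * c * ρb) ≤ ρr * (2 * c * ρb) := mul_le_mul_of_nonneg_right g1 g3
            _ ≤ ρr * (3 * c * ρb - 2 * ε - 3 * c * ε) := mul_le_mul_of_nonneg_left g2 hρr0.le
        have f5 : ε * (ρb * U ^ 2 + 2 * ρb * U + ε) ≤ c * ρb ^ 2 := by
          have g1 : ε * (U ^ 2 + 2 * U) ≤ c ^ 2 := by
            have hUB : U ^ 2 + 2 * U ≤ B ^ 2 + 2 * B + 3 * c + 2 := by linarith
            exact (mul_le_mul_of_nonneg_left hUB hε0).trans hεD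
          have g2 : c ^ 2 ≤ c * ρb / 2 := by linarith
          have g3 : ρb * (ε * (U ^ 2 + 2 * U)) ≤ ρb * (c * ρb / 2) :=
            mul_le_mul_of_nonneg_left (g1.trans g2) hρb0.le
          have g4 : ε ^ 2 ≤ c * ρb ^ 2 / 2 := by
            have e1 : ε * ε ≤ (c ^ 2 / 2) * (c / 3) :=
              mul_le_mul (by linarith) (by linarith) hε0 (by positivity)
            have e2 : c * c ^ 2 ≤ c * ρb ^ 2 :=
              mul_le_mul_of_nonneg_left (pow_le_pow_left₀ hc.le (by linarith : c ≤ ρb) 2) hc.le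
            have e3 : 0 ≤ c * ρb ^ 2 := by positivity
            nlinarith [e1, e2, e3]
          linarith [g3, g4]
        linarith [f1, f2, f3, f4, f5]
      linarith [hP, h2er, hM2]
    have hρr0' : ρr ≠ 0 := hρr0.ne'
    have h23 : 2 / 3 * (er / ρr - ‖mr‖ ^ 2 / (2 * ρr ^ 2)) = (2 * er * ρr - ‖mr‖ ^ 2) / (3 * ρr ^ 2) := by
      field_simp
    rw [h23, le_div_iff₀ (mul_pos (by norm_num) (pow_pos hρr0 2))]
    linarith [key]

end Summit.AtomisticToContinuum.HydrodynamicLimit.Theorems.LocalSecondLawLedger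

end
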